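import Mathlib
import Summits.RiemannHypothesis.RiemannHypothesis.Theorems.WeilFarFloorCoshQuotientContinuity
import HarnessLib

/-!
# The gap energy `(λ_max − R_c)·R_c` and the weighted gap `e^a(λ_max − R_c)` are integrable on every `[1, A]` (RH-free)

Helper file (`--supports stmt-RiemannHypothesis-0098`, lead-track anchor: Weil-positivity window ladder, format-C far bound),
pure proofs over BUILT imports.  Seat rh-explicit-weil-1 gen16 (memo `run/shared/lean/pub/rh-explicit/rh-explicit-weil-1/FORMAT-K3.md` §17).

Measurability inputs of the Cesàro laws for the far-coercivity floor gap (`WeilFarFloorCoshGapMeanRH`, `WeilFarFloorCoshGapOscillationRH`):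
the floor `λ_max = farCoercivityFloor` is monotone on `(0, ∞)` (`farCoercivityFloor_mono`), the cosh quotient
`R_c(a) = Q_a(C_a)/(a + sinh a)` is continuous on `[1, ∞)` (locally Lipschitz: `FloorCoshSplit.abs_coshQuotient_sub_le`), hence
`a ↦ (λ_max(a) − R_c(a))·R_c(a)` and `a ↦ e^a·(λ_max(a) − R_c(a))` are interval integrable on `[1, A]` (monotone × continuous);
and the elementary `a² ≤ 4(a + sinh a)`.  Everything here is RH-free.  Standard axioms only.  Nothing here bears on the truth of RH.
-/

set_option linter.dupNamespace false
set_option autoImplicit false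

noncomputable section

open MeasureTheory Set Filter Topology
open scoped Real BigOperators ArithmeticFunction.vonMangoldt Chebyshev

namespace Summit.RiemannHypothesis.RiemannHypothesis.Theorems.WeilFormatC

namespace FloorResidualMean

open Literature.NumberTheory.LFunctions FloorCosh FloorCoshSplit

/-! ## §1 Monotone floor, continuous cosh quotient -/

/-- The floor is monotone on `(0, ∞)`. -/
theorem monotoneOn_farCoercivityFloor : MonotoneOn farCoercivityFloor (Ioi 0) :=
  fun _ ha _ _ hab ↦ farCoercivityFloor_mono ha hab

/-- The cosh quotient `R_c` is continuous on `[1, ∞)` (locally Lipschitz, `FloorCoshSplit.abs_coshQuotient_sub_le`). -/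
theorem continuousOn_coshQuotient :
    ContinuousOn (fun a : ℝ ↦ primeShiftForm a ((Icc (-a) a).indicator (fun y ↦ Real.cosh (y / 2))) / (a + Real.sinh a))
      (Ici 1) := by
  set R : ℝ → ℝ := fun a ↦ primeShiftForm a ((Icc (-a) a).indicator (fun y ↦ Real.cosh (y / 2))) / (a + Real.sinh a) with hR
  rw [Metric.continuousOn_iff]
  intro x₀ hx₀ ε hε
  have hx₀1 : 1 ≤ x₀ := hx₀
  set L := 200 * Real.exp (2 * (x₀ + 1)) + 1 with hL
  have hL0 : 0 < L := by positivity
  refine ⟨min 1 (ε / L), lt_min one_pos (by positivity), fun x hx hdist ↦ ?_⟩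
  have hx1 : 1 ≤ x := hx
  have hd1 : |x - x₀| < 1 := lt_of_lt_of_le (by rwa [Real.dist_eq] at hdist) (min_le_left _ _)
  have hd2 : |x - x₀| < ε / L := lt_of_lt_of_le (by rwa [Real.dist_eq] at hdist) (min_le_right _ _)
  have hnorm : ∀ t : ℝ, 1 ≤ t → 1 ≤ t + Real.sinh t := fun t ht ↦ by
    have := Real.sinh_nonneg_iff.2 (by linarith : (0 : ℝ) ≤ t); linarith
  -- |R x − R x₀| ≤ 200 |x − x₀| e^{2(x₀+1)}
  have hkey : |R x - R x₀| ≤ 200 * |x - x₀| * Real.exp (2 * (x₀ + 1)) := by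
    rcases le_or_gt x₀ x with hle | hlt
    · have h := abs_coshQuotient_sub_le (a := x₀) (a' := x) (by linarith) hle
      have hden := hnorm x₀ hx₀1
      have hexp : Real.exp (2 * x) ≤ Real.exp (2 * (x₀ + 1)) := Real.exp_le_exp.2 (by linarith [(abs_lt.1 hd1).2])
      have hxx : x - x₀ = |x - x₀| := (abs_of_nonneg (by linarith)).symm
      calc |R x - R x₀| ≤ 200 * (x - x₀) * Real.exp (2 * x) / (x₀ + Real.sinh x₀) := h
        _ ≤ 200 * (x - x₀) * Real.exp (2 * x) := div_le_self (by positivity) hden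
        _ ≤ 200 * |x - x₀| * Real.exp (2 * (x₀ + 1)) := by
            rw [← hxx]; exact mul_le_mul_of_nonneg_left hexp (by positivity)
    · have h := abs_coshQuotient_sub_le (a := x) (a' := x₀) (by linarith) hlt.le
      have hden := hnorm x hx1
      have hexp : Real.exp (2 * x₀) ≤ Real.exp (2 * (x₀ + 1)) := Real.exp_le_exp.2 (by linarith)
      have hxx : x₀ - x = |x - x₀| := by rw [abs_sub_comm]; exact (abs_of_nonneg (by linarith)).symm
      rw [abs_sub_comm]
      calc |R x₀ - R x| ≤ 200 * (x₀ - x) * Real.exp (2 * x₀) / (x + Real.sinh x) := h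
        _ ≤ 200 * (x₀ - x) * Real.exp (2 * x₀) := div_le_self (by positivity) hden
        _ ≤ 200 * |x - x₀| * Real.exp (2 * (x₀ + 1)) := by
            rw [← hxx]; exact mul_le_mul_of_nonneg_left hexp (by positivity)
  rw [Real.dist_eq]
  have h1 : 200 * |x - x₀| * Real.exp (2 * (x₀ + 1)) ≤ L * |x - x₀| := by
    rw [hL]; nlinarith [abs_nonneg (x - x₀)]
  have h2 : |x - x₀| * L < ε := (lt_div_iff₀ hL0).1 hd2
  linarith [mul_comm L |x - x₀|]

/-- `a²/(a + sinh a) ≤ 4` for `a ≥ 0` (`sinh a ≥ a/2 + a²/4` from `e^a ≥ 1 + a + a²/2`). -/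
theorem sq_div_norm_le_four {a : ℝ} (ha : 0 ≤ a) : a ^ 2 ≤ 4 * (a + Real.sinh a) := by
  have h1 := Real.quadratic_le_exp_of_nonneg ha
  have h2 : Real.exp (-a) ≤ 1 := Real.exp_le_one_iff.2 (by linarith)
  rw [Real.sinh_eq]
  nlinarith [Real.exp_pos (-a)]

/-! ## §2 Integrability of the gap energy and of the weighted gap -/

/-- The gap energy `(λ_max − R_c)·R_c` is integrable on every `[1, A]`. -/
theorem intervalIntegrable_gapEnergy (A : ℝ) (hA : 1 ≤ A) :
    IntervalIntegrable (fun a : ℝ ↦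
      (farCoercivityFloor a - primeShiftForm a ((Icc (-a) a).indicator (fun y ↦ Real.cosh (y / 2))) / (a + Real.sinh a))
        * (primeShiftForm a ((Icc (-a) a).indicator (fun y ↦ Real.cosh (y / 2))) / (a + Real.sinh a))) volume 1 A := by
  have hsub : uIcc 1 A ⊆ Ici 1 := by rw [uIcc_of_le hA]; exact fun x hx ↦ hx.1
  have hsub' : uIcc 1 A ⊆ Ioi 0 := fun x hx ↦
    Set.mem_Ioi.2 (lt_of_lt_of_le one_pos (show (1 : ℝ) ≤ x from hsub hx))
  have hR : ContinuousOn (fun a : ℝ ↦ primeShiftForm a ((Icc (-a) a).indicator (fun y ↦ Real.cosh (y / 2)))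
      / (a + Real.sinh a)) (uIcc 1 A) := continuousOn_coshQuotient.mono hsub
  have hfl : IntervalIntegrable farCoercivityFloor volume 1 A := (monotoneOn_farCoercivityFloor.mono hsub').intervalIntegrable
  have h1 := hfl.mul_continuousOn hR
  have h2 : IntervalIntegrable (fun a : ℝ ↦ primeShiftForm a ((Icc (-a) a).indicator (fun y ↦ Real.cosh (y / 2)))
      / (a + Real.sinh a) * (primeShiftForm a ((Icc (-a) a).indicator (fun y ↦ Real.cosh (y / 2))) / (a + Real.sinh a)))
      volume 1 A := (hR.mul hR).intervalIntegrable
  exact (h1.sub h2).congr fun a _ ↦ by ring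

/-- The `e^a`-weighted gap is integrable on every `[1, A]`. -/
theorem intervalIntegrable_exp_mul_gap (A : ℝ) (hA : 1 ≤ A) :
    IntervalIntegrable (fun a : ℝ ↦ Real.exp a *
      (farCoercivityFloor a - primeShiftForm a ((Icc (-a) a).indicator (fun y ↦ Real.cosh (y / 2))) / (a + Real.sinh a)))
      volume 1 A := by
  have hsub : uIcc 1 A ⊆ Ici 1 := by rw [uIcc_of_le hA]; exact fun x hx ↦ hx.1
  have hsub' : uIcc 1 A ⊆ Ioi 0 := fun x hx ↦
    Set.mem_Ioi.2 (lt_of_lt_of_le one_pos (show (1 : ℝ) ≤ x from hsub hx))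
  have hR : ContinuousOn (fun a : ℝ ↦ primeShiftForm a ((Icc (-a) a).indicator (fun y ↦ Real.cosh (y / 2)))
      / (a + Real.sinh a)) (uIcc 1 A) := continuousOn_coshQuotient.mono hsub
  have hfl : IntervalIntegrable farCoercivityFloor volume 1 A := (monotoneOn_farCoercivityFloor.mono hsub').intervalIntegrable
  have h1 := (hfl.sub hR.intervalIntegrable).continuousOn_mul (Real.continuous_exp.continuousOn)
  exact h1

end FloorResidualMean

end Summit.RiemannHypothesis.RiemannHypothesis.Theorems.WeilFormatC
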